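import Mathlib
import Literature.Analysis.FluidPDE.TaoEnstrophyLocalisation
import Summits.NavierStokesRegularity.NavierStokesRegularity.Theorems.StretchingWellBindingEnstrophyQuarterLawSieveCovering
import Summits.NavierStokesRegularity.NavierStokesRegularity.Theorems.StretchingWellBindingEnstrophyQuarterLawSieveTools
import HarnessLib

/-!
# Shelf crux `EnstrophyQuarterLaw` (stmt-NavierStokesRegularity-1574), line «sparse_sieve»:
# counting and arithmetic for the dyadic sieve (`stub_sieve`, part 3 of 5)

Theorems helper file (seat ns-hhe-c1 g2; `--supports` the shelf crux). Small conversions used by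
the dyadic ε-regularity sieve (`core_window_bound`, next file) proving the registered stub
`stub_sieve` of `Cruxes/EnstrophyQuarterLaw/Lines/sparse_sieve.lean`:

* `enorm_curl_sq_le_opNorm` — `|curl v(x)|² ≤ ‖curlCLM‖² ‖Dv(x)‖²` in `ℝ≥0∞` (operator norm;
  the tree's `norm_curl_le`);
* `sum_const_ofReal_le` — a constant sum over a finite set of bounded size;
* `sieve_arith` — the real arithmetic of the sieve: the level costs `n⋆ C τ / R_j` (`j ≤ J`, a
  geometric series, `τ ≤ σ R_J²/4`) plus the core cost `N M √(τ/σ')` are at most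
  `(n⋆ C √σ + N M/√σ') √τ`;
* `card_lattice_filter_le` — SPARSENESS BOUNDS THE BAD INDICES OF A LEVEL: if every `4R`-separated
  family of centres whose `2R`-balls carry `∫|u(t)|³ ≥ γ³` has `≤ N₀` members, then any finite set
  of lattice indices (spacing `R/4`) with that property has `≤ 16³ N₀ = 4096 N₀` members (residue
  classes mod `16` are `4R`-separated: `card_le_of_separated_subfamilies`).

HONEST FRAMING: bookkeeping lemmas; nothing here bears on the regularity problem and no summit
statement is proved.
-/

noncomputable section

-- the summit and its single sub-problem share the name (CONVENTIONS §1), as in every Theorems file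
set_option linter.dupNamespace false

namespace Summit.NavierStokesRegularity.NavierStokesRegularity.Theorems.EnstrophyQuarterLaw.SparseSieve

open MeasureTheory Set Metric Finset Filter Topology Function
open Literature.Analysis Literature.Analysis.FluidPDE
open scoped ENNReal NNReal

/-! ### Small conversions -/

/-- `|curl v(x)|² ≤ ‖curlCLM‖² ‖Dv(x)‖²` in `ℝ≥0∞` (operator norm of the Jacobian). [folklore] -/
theorem enorm_curl_sq_le_opNorm (v : EuclideanSpace ℝ (Fin 3) → EuclideanSpace ℝ (Fin 3))
    (x : EuclideanSpace ℝ (Fin 3)) :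
    ‖curl v x‖ₑ ^ 2 ≤
      ENNReal.ofReal (‖(curlCLM : (EuclideanSpace ℝ (Fin 3) →L[ℝ] EuclideanSpace ℝ (Fin 3)) →L[ℝ]
        EuclideanSpace ℝ (Fin 3))‖ ^ 2) * ‖fderiv ℝ v x‖ₑ ^ 2 := by
  rw [← ofReal_norm, ← ofReal_norm, ← ENNReal.ofReal_pow (norm_nonneg _),
    ← ENNReal.ofReal_pow (norm_nonneg _), ← ENNReal.ofReal_mul (sq_nonneg _), ← mul_pow]
  exact ENNReal.ofReal_le_ofReal (pow_le_pow_left₀ (norm_nonneg _) (norm_curl_le v x) 2)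

/-- A constant sum over a finite set whose size is at most `B`: `∑_{k∈s} x ≤ B·x` in `ℝ≥0∞`
(`x ≥ 0`). [folklore] -/
theorem sum_const_ofReal_le {α : Type*} (s : Finset α) {x B : ℝ} (hx : 0 ≤ x)
    (hB : (s.card : ℝ) ≤ B) : ∑ _k ∈ s, ENNReal.ofReal x ≤ ENNReal.ofReal (B * x) := by
  rw [Finset.sum_const, nsmul_eq_mul, ← ENNReal.ofReal_natCast, ← ENNReal.ofReal_mul (Nat.cast_nonneg _)]
  exact ENNReal.ofReal_le_ofReal (mul_le_mul_of_nonneg_right hB hx)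

/-- **The arithmetic of the sieve.** With `τ ≤ σ (R₀ 2^{-J})²/4` (the stopping level), the level
costs `n⋆ C τ / R_j`, `j = 0, …, J`, and the core cost `N M √(τ/σ')` add up to at most
`(n⋆ C √σ + N M / √σ') √τ`. [folklore] -/
theorem sieve_arith {R₀ σ σ' τ C M nstar N : ℝ} (J : ℕ) (hR₀ : 0 < R₀) (hσ : 0 < σ)
    (hσ' : 0 < σ') (hτ : 0 < τ) (hC : 0 ≤ C) (hn : 0 ≤ nstar)
    (hJ : τ ≤ σ * (R₀ / 2 ^ J) ^ 2 / 4) :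
    nstar * (C * τ / (R₀ / 2 ^ 0)) + ∑ j ∈ Finset.range J, nstar * (C * τ / (R₀ / 2 ^ (j + 1)))
      + N * (M * Real.sqrt (τ / σ')) ≤
      (nstar * C * Real.sqrt σ + N * M / Real.sqrt σ') * Real.sqrt τ := by
  -- the level sum is a geometric series
  have hsum : nstar * (C * τ / (R₀ / 2 ^ 0)) + ∑ j ∈ Finset.range J, nstar * (C * τ / (R₀ / 2 ^ (j + 1)))
      = nstar * C * τ * ∑ j ∈ Finset.range (J + 1), (2 : ℝ) ^ j / R₀ := by
    rw [Finset.sum_range_succ' (fun j => (2 : ℝ) ^ j / R₀), mul_add, Finset.mul_sum, add_comm]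
    congr 1
    · refine Finset.sum_congr rfl fun j _ => ?_
      rw [div_div_eq_mul_div]; ring
    · rw [div_div_eq_mul_div]; ring
  have hgeom := sum_range_two_pow_div_le hR₀ J
  set ℓ : ℝ := R₀ / 2 ^ J with hℓ
  have hℓpos : 0 < ℓ := by positivity
  have h2J : 2 * 2 ^ J / R₀ = 2 / ℓ := by rw [hℓ]; field_simp
  -- `2 τ / ℓ ≤ √σ √τ` from `4 τ ≤ σ ℓ²`
  have h4 : 4 * τ ≤ σ * ℓ ^ 2 := by rw [hℓ]; linarith
  have hsq1 : Real.sqrt (4 * τ) = 2 * Real.sqrt τ := by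
    rw [Real.sqrt_mul (by norm_num : (0 : ℝ) ≤ 4), show (4 : ℝ) = 2 ^ 2 by norm_num,
      Real.sqrt_sq (by norm_num : (0 : ℝ) ≤ 2)]
  have hsq2 : Real.sqrt (σ * ℓ ^ 2) = Real.sqrt σ * ℓ := by
    rw [Real.sqrt_mul hσ.le, Real.sqrt_sq hℓpos.le]
  have h5 : 2 * Real.sqrt τ ≤ Real.sqrt σ * ℓ := by
    rw [← hsq1, ← hsq2]; exact Real.sqrt_le_sqrt h4
  have hττ : Real.sqrt τ * Real.sqrt τ = τ := Real.mul_self_sqrt hτ.le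
  have h8 : 0 ≤ Real.sqrt τ := Real.sqrt_nonneg _
  have h10 : 2 * Real.sqrt τ * Real.sqrt τ ≤ Real.sqrt σ * ℓ * Real.sqrt τ :=
    mul_le_mul_of_nonneg_right h5 h8
  have h6 : τ * (2 / ℓ) ≤ Real.sqrt σ * Real.sqrt τ := by
    rw [mul_div_assoc', div_le_iff₀ hℓpos]
    nlinarith [h10, hττ]
  have hterm1 : nstar * C * τ * ∑ j ∈ Finset.range (J + 1), (2 : ℝ) ^ j / R₀ ≤
      nstar * C * Real.sqrt σ * Real.sqrt τ := by
    calc nstar * C * τ * ∑ j ∈ Finset.range (J + 1), (2 : ℝ) ^ j / R₀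
        ≤ nstar * C * τ * (2 * 2 ^ J / R₀) := mul_le_mul_of_nonneg_left hgeom (by positivity)
      _ = nstar * C * (τ * (2 / ℓ)) := by rw [h2J]; ring
      _ ≤ nstar * C * (Real.sqrt σ * Real.sqrt τ) := mul_le_mul_of_nonneg_left h6 (by positivity)
      _ = nstar * C * Real.sqrt σ * Real.sqrt τ := by ring
  have hterm2 : N * (M * Real.sqrt (τ / σ')) = N * M / Real.sqrt σ' * Real.sqrt τ := by
    rw [Real.sqrt_div hτ.le]
    have : Real.sqrt σ' ≠ 0 := (Real.sqrt_pos.2 hσ').ne'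
    field_simp
  rw [hsum, hterm2, add_mul]
  linarith

/-! ### Counting bad lattice indices by sparseness -/

/-- **Sparseness bounds the bad indices of a level.** If every `4R`-separated finite family of
centres whose `2R`-balls carry `∫ |u(t)|³ ≥ γ³` has at most `N₀` members, then any finite set of
lattice indices (spacing `R/4`) all of whose `2R`-balls carry that mass has at most `4096 N₀`
members (residue classes mod `16` are `4R`-separated; `card_le_of_separated_subfamilies`). [folklore] -/
theorem card_lattice_filter_le {u : ℝ → EuclideanSpace ℝ (Fin 3) → EuclideanSpace ℝ (Fin 3)}
    {t R γ : ℝ} {N₀ : ℕ} (hR : 0 < R)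
    (hN : ∀ F : Finset (EuclideanSpace ℝ (Fin 3)),
      (∀ x ∈ F, ∀ y ∈ F, x ≠ y → 4 * R ≤ dist x y) →
      (∀ x ∈ F, ENNReal.ofReal (γ ^ 3) ≤ ∫⁻ y in ball x (2 * R), ‖u t y‖ₑ ^ 3) → F.card ≤ N₀)
    (S : Finset (Fin 3 → ℤ))
    (hS : ∀ k ∈ S, ENNReal.ofReal (γ ^ 3) ≤
      ∫⁻ y in ball (WithLp.toLp 2 fun i => R / 4 * (k i : ℝ) : EuclideanSpace ℝ (Fin 3)) (2 * R),
        ‖u t y‖ₑ ^ 3) :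
    S.card ≤ 4096 * N₀ := by
  classical
  have hs : 0 < R / 4 := by positivity
  refine card_le_of_separated_subfamilies hs S N₀ fun F hF hsep => ?_
  set pt : (Fin 3 → ℤ) → EuclideanSpace ℝ (Fin 3) := fun k => WithLp.toLp 2 fun i => R / 4 * (k i : ℝ)
    with hpt
  have hinj : Function.Injective pt := by
    intro k k' h
    funext i
    have h1 : (pt k) i = (pt k') i := by rw [h]
    have h2 : R / 4 * (k i : ℝ) = R / 4 * (k' i : ℝ) := h1
    exact_mod_cast mul_left_cancel₀ hs.ne' h2
  rw [← Finset.card_image_of_injective F hinj]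
  refine hN (F.image pt) ?_ ?_
  · intro x hx y hy hxy
    obtain ⟨k, hk, rfl⟩ := Finset.mem_image.1 hx
    obtain ⟨k', hk', rfl⟩ := Finset.mem_image.1 hy
    have hkk' : k ≠ k' := fun h => hxy (by rw [h])
    have h16 := hsep k hk k' hk' hkk'
    have e : 4 * R = 16 * (R / 4) := by ring
    rw [e]; exact h16
  · intro x hx
    obtain ⟨k, hk, rfl⟩ := Finset.mem_image.1 hx
    exact hS k (hF hk)

end Summit.NavierStokesRegularity.NavierStokesRegularity.Theorems.EnstrophyQuarterLaw.SparseSieve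

end
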